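/-
Copyright (c) 2026 the pub-hodgecm-mathlib formalisation cell (harness21).  Prover seat hodgecm-mathlib-K2E1-p12 (g2), Track B ∕ K2-LIT, h413 = `stmt-HodgeConjecture-24833`,
line `K2_E1_TraceFormulaBeta`, dealer K2E1-plan (g7) (232)∕(238)∕(241) «F3d-α», file α-1 (the torus action on a left-`N(𝔸)B(F)`-invariant family): the continuous
section `σ : 𝕀_E → T(𝔸_F)` of the first diagonal entry (`N = 2`, `c² = 1`), the bookkeeping `ψ(σ(x)·b·g) = ψ(σ(x·b₀₀)·g)` for `b ∈ B(𝔸_F)`, and the descent of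
`(x, g) ↦ ψ(σ(x) g)` to a jointly continuous kernel on `C_E × G` supported, for each `g`, in a compact norm shell.  THEOREMS ONLY.
-/
import Literature.NumberTheory.Automorphic.UnitaryGroupTorusLineUnfoldingTwo          -- ★ `d₀ = diagUnit · 0` on `T(𝔸_F)`: continuous, injective, surjective + open (`c² = 1`), `T(F) ↦ E^×`
import Literature.NumberTheory.Automorphic.UnitaryGroupBorelModulusThree               -- ★ `torusInBorel_comm` (rank-generic)
import Literature.NumberTheory.Automorphic.UnitaryGroupBorelConstantTermInvariance     -- ★ `conj_mem_adelicUnipotent`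
import Literature.NumberTheory.Automorphic.UnitaryGroupBorelSiegelSetStructure         -- ★ `diagUnit_torusPart`
import Literature.NumberTheory.Automorphic.UnitaryGroupUnipotentHaarTorusConj          -- ★ `torusPart_inv`
import Literature.NumberTheory.Automorphic.UnitaryGroupTruncatedTraceClassElliptic     -- ★ `locallyCompactSpace_quasiSplitAdelic`, `secondCountableTopology_quasiSplitAdelic`
import Literature.NumberTheory.Automorphic.UnitaryGroupBorelHeightContinuous           -- ★ `continuous_borelHeight`
import Literature.NumberTheory.Automorphic.UnitaryGroupTorusSiegelIntegral             -- ★ `borelHeight_pos`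
import Summits.HodgeConjecture.HodgeConjecture.Theorems.K2E1ChiSectionBridgeU2         -- ★ `firstEntryUnit`, `firstEntryUnit_mul`, `ideleNorm_firstEntryUnit`
import Summits.HodgeConjecture.HodgeConjecture.Theorems.K2E1ChiSectionSpaceU2Defs      -- ★ `firstEntryUnit_eq_diagUnit_zero`
import Summits.HodgeConjecture.HodgeConjecture.Theorems.K2E1NormOneIdeleClassRetractionU  -- ★ α-0: `continuous_norm`, `compactSpace_normOne`
import Literature.NumberTheory.Automorphic.IdeleClassBaseChangeProper                  -- ★ `isCompact_norm_preimage_of_isCompact` (norm shells of `C_E` are compact)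
import Mathlib.MeasureTheory.Integral.Bochner.Set
import HarnessLib

/-!
# K2·E1 — `K2E1NormOneTorusFamilyActionU2` (F3d-α, file α-1): the idele class group acting on left-`N(𝔸)B(F)`-invariant families on `U(1,1)(𝔸_F)`

Track B ∕ K2-LIT, crux h413 = `stmt-HodgeConjecture-24833`, route `HCCMUnconditional`; cell `hodgecm-mathlib`, squad K2, ENGINE E1, ROADCARD C7 «families» (K2E1-p10 (g2)'s F3 split,
★ p860399 `K2E1PseudoEisensteinFamilyDecompositionU2`, binder `hα`).  THEOREMS ONLY (no `def`, no `instance`, no notation, no named-fact hypothesis, no `sorry`); lane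
`--supports stmt-HodgeConjecture-24833 --as helper` (count-neutral).  Closes no socket.  Generic quasi-split pair `(F, E, c)`, rank `N = 2`, `c² = 1` where the torus is unfolded.

THE MATHEMATICS ([MoeglinWaldspurger1995, §II.1.1–§II.1.3]; [Garrett2018, §2.10–§2.11]; [Rogawski1990, §1.10]).  For `U(1,1)` the diagonal torus is `T(𝔸_F) = {diag(x, c(x)⁻¹)} ≅ 𝕀_E`
through the first entry `d₀` (★ `UnitaryGroupTorusLineUnfoldingTwo`: a continuous bijective open homomorphism when `c² = 1`), so it has a continuous inverse `σ` (§1).  For a function `ψ`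
on `G = U(1,1)(𝔸_F)` that is left-`N(𝔸_F)`- and left-`B(F)`-invariant, `x ↦ ψ(σ(x) g)` is invariant under `E^×` (`σ(E^×) = T(F) ⊆ B(F)`), `ψ(σ(x)·b·g) = ψ(σ(x b₀₀)·g)` for every
`b ∈ B(𝔸_F)` (`b = n · torusPart b`, `torusPart b = σ(b₀₀)`), and `ψ(σ(x)·γ·g) = ψ(σ(x)·g)` for `γ ∈ B(F)` (the commutator `[σ(x), γ]` is unipotent because torus parts commute) (§2–§3).  Hence
`(x, g) ↦ ψ(σ(x) g)` descends to a jointly continuous kernel `Φ` on `C_E × G` (open quotient map `𝕀_E × G → C_E × G`) with `Φ(c, b g) = Φ(c·[b₀₀], g)`, `Φ(c, γ g) = Φ(c, g)`, and — when `ψ`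
lives in the height band `a ≤ H ≤ b`, `0 < a` — `Φ(c, g) ≠ 0 ⇒ a ≤ ‖c‖·H(g) ≤ b`, a COMPACT shell of `C_E = C_E¹ × r_∞(ℝ_{>0})` (§4–§5).  File α-2 integrates `Φ` against characters of the
compact group `C_E¹` (★ α-0) to produce the isotypic projections `P_χ` of K2E1-p10 (g2)'s `hα`.
* §1 `exists_torusSection_two` · §2 `apply_borel_mul_unipotent_mul`, `apply_borel_mul_rational_mul`, `apply_borel_mul_eq_torusPart_mul`, `borelHeight_borel_mul_firstEntryUnit` ·
  §3 `sigma_firstEntryUnit_torusPart`, `apply_sigma_mul_borel_mul`, `sigma_mem_arithmeticSubgroup_of_mem_principalIdeles`, `apply_sigma_mul_of_mem_principalIdeles` ·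
  §4 `exists_kernel` (descent + joint continuity) · §5 `isCompact_normShell`, `norm_mul_borelHeight_mem_of_kernel_ne_zero`.
HONEST LABEL: HC_CM is proved only modulo the 7 printed citations (2 remaining named inputs: hLiu418 = `stmt-HodgeConjecture-24832`, h413 = `stmt-HodgeConjecture-24833`) until rung 0
closes; this file is letter-free and closes no socket.
References: [MoeglinWaldspurger1995] C. Mœglin, J.-L. Waldspurger, *Spectral decomposition and Eisenstein series*, §II.1 · [Garrett2018] P. Garrett, *Modern analysis of automorphic
forms by example*, §2.10–§2.11 · [Rogawski1990] J. Rogawski, *Automorphic representations of unitary groups in three variables*, §1.10 · [WeilBNT1967] Ch. IV §4.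
-/

set_option autoImplicit false
-- the mandated namespace repeats the single-problem summit's segment (`HodgeConjecture.HodgeConjecture`)
set_option linter.dupNamespace false

noncomputable section

open NumberField IsDedekindDomain Set Filter Topology Function
open scoped NNReal
open Literature.NumberTheory.Automorphic Literature.NumberTheory.Automorphic.UnitaryGroup Literature.NumberTheory.GaloisRepresentations
open Summit.HodgeConjecture.HodgeConjecture.Cruxes.H413.K2E1CharacterEisensteinU2Defs Summit.HodgeConjecture.HodgeConjecture.Cruxes.H413.K2E1ChiSectionSpaceU2Defs
  Summit.HodgeConjecture.HodgeConjecture.Cruxes.H413.K2E1ChiSectionBridgeU2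

namespace Summit.HodgeConjecture.HodgeConjecture.Cruxes.H413.K2E1NormOneTorusFamilyActionU2

variable {F E : Type} [Field F] [NumberField F] [Field E] [NumberField E] [Algebra F E] {c : E ≃ₐ[F] E}

/-! ## §1 The continuous section `σ : 𝕀_E → T(𝔸_F)` of the first diagonal entry (`N = 2`, `c² = 1`) -/

/-- **The torus of `U(1,1)(𝔸_F)` is `𝕀_E`, continuously in both directions** (`c² = 1`): there is a continuous multiplicative `σ : 𝕀_E → T(𝔸_F)` with `σ(x)₀₀ = x` and
`σ(t₀₀) = t` — the inverse of ★ `d₀` (continuous, bijective, open). [cite: Rogawski1990, §1.10] -/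
theorem exists_torusSection_two (hc : c * c = 1) :
    ∃ σ : ideleGroup E → ↥(torusInBorel F E c 2), Continuous σ ∧ (∀ x y, σ (x * y) = σ x * σ y) ∧
      (∀ x, firstEntryUnit (σ x).1.2 = x) ∧ ∀ t : ↥(torusInBorel F E c 2), σ (firstEntryUnit t.1.2) = t := by
  set d₀ : ↥(torusInBorel F E c 2) →* (AdeleRing (𝓞 E) E)ˣ :=
    MonoidHom.mk' (fun t : torusInBorel F E c 2 => diagUnit (t : borelAdelic F E c 2).2 0) (fun t t' => diagUnit_torus_mul_two t t' 0) with hd₀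
  have hcont : Continuous d₀ := continuous_diagUnitZeroHom_two
  have hbij : Function.Bijective d₀ := ⟨diagUnitZeroHom_two_injective, diagUnitZeroHom_two_surjective hc⟩
  have hopen : IsOpenMap d₀ := isOpenMap_diagUnitZeroHom_two hc
  set e : ↥(torusInBorel F E c 2) ≃ₜ ideleGroup E := Equiv.toHomeomorphOfContinuousOpen (Equiv.ofBijective d₀ hbij) hcont hopen with he
  have he' : ∀ t, e t = d₀ t := fun t => by rw [he, Equiv.toHomeomorphOfContinuousOpen_apply, Equiv.ofBijective_apply]
  have hsymm : ∀ z, d₀ (e.symm z) = z := fun z => by rw [← he']; exact e.apply_symm_apply z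
  have hfe : ∀ t : ↥(torusInBorel F E c 2), firstEntryUnit t.1.2 = d₀ t := fun t => firstEntryUnit_eq_diagUnit_zero t.1.2
  refine ⟨e.symm, e.symm.continuous, fun x y => hbij.1 ?_, fun x => ?_, fun t => ?_⟩
  · rw [hsymm, map_mul, hsymm, hsymm]
  · rw [hfe, hsymm]
  · rw [hfe, ← he']; exact e.symm_apply_apply t

/-! ## §2 Bookkeeping on `G`: left-`N(𝔸)`-invariance under Borel translates, `B(F)` on the right of a Borel element, torus parts, heights -/

/-- For left-`N(𝔸)`-invariant `ψ` and `b ∈ B(𝔸_F)`: `ψ(b·u·g) = ψ(b·g)` (`b u b⁻¹ ∈ N(𝔸_F)`, `N` normal in `B`). [cite: MoeglinWaldspurger1995, §II.1.1] -/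
theorem apply_borel_mul_unipotent_mul {M : Type*} {ψ : (quasiSplit F E c 2).Adelic → M}
    (hψU : ∀ (u : adelicUnipotent F E c 2) (g : (quasiSplit F E c 2).Adelic), ψ ((u : (quasiSplit F E c 2).Adelic) * g) = ψ g)
    {b : (quasiSplit F E c 2).Adelic} (hb : b ∈ borelAdelic F E c 2) {u : (quasiSplit F E c 2).Adelic} (hu : u ∈ adelicUnipotent F E c 2)
    (g : (quasiSplit F E c 2).Adelic) : ψ (b * (u * g)) = ψ (b * g) := by
  have h := conj_mem_adelicUnipotent (Subgroup.inv_mem _ hb) hu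
  rw [inv_inv] at h
  have := hψU ⟨b * u * b⁻¹, h⟩ (b * g)
  have hprod : b * u * b⁻¹ * (b * g) = b * (u * g) := by group
  rwa [Subgroup.coe_mk, hprod] at this

/-- `torusPart 1 = 1` and the torus part of a commutator of Borel elements is trivial (torus parts commute, ★ `torusInBorel_comm`). [cite: Rogawski1990, §1.10] -/
theorem torusPart_commutator_eq_one (b b' : borelAdelic F E c 2) : torusPart (b * b' * b⁻¹ * b'⁻¹) = 1 := by
  have ht : ∀ x : borelAdelic F E c 2, torusPart x ∈ torusInBorel F E c 2 := fun x => (mem_torusInBorel_iff _).2 (torusPart_mem_torusAdelic x)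
  have hcomm : torusPart b * torusPart b' = torusPart b' * torusPart b :=
    congrArg Subtype.val (torusInBorel_comm ⟨torusPart b, ht b⟩ ⟨torusPart b', ht b'⟩)
  rw [torusPart_mul, torusPart_mul, torusPart_mul, torusPart_inv, torusPart_inv, hcomm, mul_inv_cancel_right, mul_inv_cancel]

/-- For left-`N(𝔸)`- and left-`B(F)`-invariant `ψ`, `b ∈ B(𝔸_F)` and `γ ∈ B(F)`: `ψ(b·γ·g) = ψ(b·g)` (`b γ = [b, γ] γ b` with `[b, γ] ∈ N(𝔸_F)`).
[cite: MoeglinWaldspurger1995, §II.1.1] -/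
theorem apply_borel_mul_rational_mul {M : Type*} {ψ : (quasiSplit F E c 2).Adelic → M}
    (hψU : ∀ (u : adelicUnipotent F E c 2) (g : (quasiSplit F E c 2).Adelic), ψ ((u : (quasiSplit F E c 2).Adelic) * g) = ψ g)
    (hψB : ∀ γ ∈ arithmeticBorel F E c 2, ∀ g : (quasiSplit F E c 2).Adelic, ψ ((γ : (quasiSplit F E c 2).Adelic) * g) = ψ g)
    {b : (quasiSplit F E c 2).Adelic} (hb : b ∈ borelAdelic F E c 2) {γ : ↥(quasiSplit F E c 2).arithmeticSubgroup} (hγ : γ ∈ arithmeticBorel F E c 2)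
    (g : (quasiSplit F E c 2).Adelic) : ψ (b * ((γ : (quasiSplit F E c 2).Adelic) * g)) = ψ (b * g) := by
  have hγB : (γ : (quasiSplit F E c 2).Adelic) ∈ borelAdelic F E c 2 := (mem_arithmeticBorel_iff γ).1 hγ
  have hu : b * γ * b⁻¹ * (γ : (quasiSplit F E c 2).Adelic)⁻¹ ∈ adelicUnipotent F E c 2 := by
    have hmem : b * γ * b⁻¹ * (γ : (quasiSplit F E c 2).Adelic)⁻¹ ∈ borelAdelic F E c 2 :=
      Subgroup.mul_mem _ (Subgroup.mul_mem _ (Subgroup.mul_mem _ hb hγB) (Subgroup.inv_mem _ hb)) (Subgroup.inv_mem _ hγB)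
    have h1 := (mem_unipotentInBorel_iff_torusPart_eq_one (⟨_, hmem⟩ : borelAdelic F E c 2)).2
      (torusPart_commutator_eq_one (⟨b, hb⟩ : borelAdelic F E c 2) ⟨γ, hγB⟩)
    exact (mem_unipotentInBorel_iff _).1 h1
  have h := hψU ⟨_, hu⟩ ((γ : (quasiSplit F E c 2).Adelic) * (b * g))
  rw [Subgroup.coe_mk] at h
  have hprod : b * γ * b⁻¹ * (γ : (quasiSplit F E c 2).Adelic)⁻¹ * ((γ : (quasiSplit F E c 2).Adelic) * (b * g)) = b * ((γ : (quasiSplit F E c 2).Adelic) * g) := by group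
  rw [hprod, hψB γ hγ] at h
  exact h

/-- For left-`N(𝔸)`-invariant `ψ` and `b ∈ B(𝔸_F)`: `ψ(b·g) = ψ(torusPart(b)·g)` (`b = n · torusPart b`, `n ∈ N(𝔸_F)`). [cite: Rogawski1990, §1.10] -/
theorem apply_borel_mul_eq_torusPart_mul {M : Type*} {ψ : (quasiSplit F E c 2).Adelic → M}
    (hψU : ∀ (u : adelicUnipotent F E c 2) (g : (quasiSplit F E c 2).Adelic), ψ ((u : (quasiSplit F E c 2).Adelic) * g) = ψ g)
    (b : borelAdelic F E c 2) (g : (quasiSplit F E c 2).Adelic) :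
    ψ ((b : (quasiSplit F E c 2).Adelic) * g) = ψ (((torusPart b : borelAdelic F E c 2) : (quasiSplit F E c 2).Adelic) * g) := by
  have hsplit : ((b : borelAdelic F E c 2) : (quasiSplit F E c 2).Adelic) =
      ((torusPart b : borelAdelic F E c 2) : (quasiSplit F E c 2).Adelic) * ((((torusPart b)⁻¹ * b : borelAdelic F E c 2)) : (quasiSplit F E c 2).Adelic) := by
    rw [Subgroup.coe_mul, Subgroup.coe_inv, mul_inv_cancel_left]
  rw [hsplit, mul_assoc]
  exact apply_borel_mul_unipotent_mul hψU (torusPart b).2 (torusPart_inv_mul_mem_adelicUnipotent b) g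

/-- **Height law through the first entry**: `H(b·g) = ‖b₀₀‖_𝔸 · H(g)` for `b ∈ B(𝔸_F)` (★ `borelHeight_borel_mul` + ★ `ideleNorm_firstEntryUnit`). [cite: Garrett2018, §2.2] -/
theorem borelHeight_borel_mul_firstEntryUnit {b : (quasiSplit F E c 2).Adelic} (hb : b ∈ borelAdelic F E c 2) (g : (quasiSplit F E c 2).Adelic) :
    borelHeight (b * g) = IdeleClassGroup.ideleNorm E (firstEntryUnit hb) * borelHeight g := by
  rw [borelHeight_borel_mul hb, ideleNorm_firstEntryUnit hb]

/-! ## §3 The section and the family: `ψ(σ(x)·b·g) = ψ(σ(x·b₀₀)·g)`, `E^×`-invariance -/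

/-- `σ(b₀₀) = torusPart b` for `b ∈ B(𝔸_F)` (both are torus elements with first entry `b₀₀`). [cite: Rogawski1990, §1.10] -/
theorem sigma_firstEntryUnit_eq_torusPart {σ : ideleGroup E → ↥(torusInBorel F E c 2)} (hσt : ∀ t : ↥(torusInBorel F E c 2), σ (firstEntryUnit t.1.2) = t)
    (b : borelAdelic F E c 2) :
    ((σ (firstEntryUnit b.2)).1 : borelAdelic F E c 2) = torusPart b := by
  have ht : torusPart b ∈ torusInBorel F E c 2 := (mem_torusInBorel_iff _).2 (torusPart_mem_torusAdelic b)
  have h1 : firstEntryUnit (torusPart b).2 = firstEntryUnit b.2 := by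
    rw [firstEntryUnit_eq_diagUnit_zero, firstEntryUnit_eq_diagUnit_zero]; exact diagUnit_torusPart b 0
  have h2 := hσt ⟨torusPart b, ht⟩
  simp only at h2
  rw [h1] at h2
  rw [h2]

/-- **The torus action on a left-`N(𝔸)`-invariant family**: `ψ(σ(x)·b·g) = ψ(σ(x·b₀₀)·g)` for `b ∈ B(𝔸_F)`. [cite: MoeglinWaldspurger1995, §II.1.3] -/
theorem apply_sigma_mul_borel_mul {M : Type*} {ψ : (quasiSplit F E c 2).Adelic → M}
    (hψU : ∀ (u : adelicUnipotent F E c 2) (g : (quasiSplit F E c 2).Adelic), ψ ((u : (quasiSplit F E c 2).Adelic) * g) = ψ g)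
    {σ : ideleGroup E → ↥(torusInBorel F E c 2)} (hσm : ∀ x y, σ (x * y) = σ x * σ y) (hσt : ∀ t : ↥(torusInBorel F E c 2), σ (firstEntryUnit t.1.2) = t)
    (x : ideleGroup E) {b : (quasiSplit F E c 2).Adelic} (hb : b ∈ borelAdelic F E c 2) (g : (quasiSplit F E c 2).Adelic) :
    ψ ((σ x).1.1 * (b * g)) = ψ ((σ (x * firstEntryUnit hb)).1.1 * g) := by
  have hB : (σ x).1.1 * b ∈ borelAdelic F E c 2 := Subgroup.mul_mem _ (σ x).1.2 hb
  rw [← mul_assoc, apply_borel_mul_eq_torusPart_mul hψU ⟨_, hB⟩ g, hσm]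
  congr 2
  have h1 : (⟨(σ x).1.1 * b, hB⟩ : borelAdelic F E c 2) = (σ x).1 * ⟨b, hb⟩ := rfl
  rw [h1, torusPart_mul, torusPart_eq_self_of_mem (σ x).2, ← sigma_firstEntryUnit_eq_torusPart hσt ⟨b, hb⟩]
  rfl

/-- `σ(E^×) ⊆ G(F)`: the section of a principal idele is a rational torus element (★ `map_rationalTorusInBorel_diagUnitZero_eq_principalIdeles_two`). [cite: Rogawski1990, §1.10] -/
theorem sigma_mem_arithmeticSubgroup_of_mem_principalIdeles (hc : c * c = 1) {σ : ideleGroup E → ↥(torusInBorel F E c 2)}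
    (hσt : ∀ t : ↥(torusInBorel F E c 2), σ (firstEntryUnit t.1.2) = t) {p : ideleGroup E} (hp : p ∈ principalIdeles E) :
    (σ p).1.1 ∈ (quasiSplit F E c 2).arithmeticSubgroup := by
  rw [← map_rationalTorusInBorel_diagUnitZero_eq_principalIdeles_two (F := F) hc] at hp
  obtain ⟨τ, hτ, hτp⟩ := hp
  rw [MonoidHom.mk'_apply, ← firstEntryUnit_eq_diagUnit_zero] at hτp
  rw [← hτp, hσt τ]
  exact hτ

/-- **`E^×`-invariance**: `ψ(σ(x·p)·g) = ψ(σ(x)·g)` for a principal idele `p` and left-`N(𝔸)B(F)`-invariant `ψ`. [cite: MoeglinWaldspurger1995, §II.1.3] -/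
theorem apply_sigma_mul_of_mem_principalIdeles (hc : c * c = 1) {M : Type*} {ψ : (quasiSplit F E c 2).Adelic → M}
    (hψU : ∀ (u : adelicUnipotent F E c 2) (g : (quasiSplit F E c 2).Adelic), ψ ((u : (quasiSplit F E c 2).Adelic) * g) = ψ g)
    (hψB : ∀ γ ∈ arithmeticBorel F E c 2, ∀ g : (quasiSplit F E c 2).Adelic, ψ ((γ : (quasiSplit F E c 2).Adelic) * g) = ψ g)
    {σ : ideleGroup E → ↥(torusInBorel F E c 2)} (hσm : ∀ x y, σ (x * y) = σ x * σ y) (hσt : ∀ t : ↥(torusInBorel F E c 2), σ (firstEntryUnit t.1.2) = t)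
    (x : ideleGroup E) {p : ideleGroup E} (hp : p ∈ principalIdeles E) (g : (quasiSplit F E c 2).Adelic) :
    ψ ((σ (x * p)).1.1 * g) = ψ ((σ x).1.1 * g) := by
  have hA := sigma_mem_arithmeticSubgroup_of_mem_principalIdeles hc hσt hp
  have hγ : (⟨(σ p).1.1, hA⟩ : ↥(quasiSplit F E c 2).arithmeticSubgroup) ∈ arithmeticBorel F E c 2 := (mem_arithmeticBorel_iff _).2 (σ p).1.2
  have h := apply_borel_mul_rational_mul hψU hψB (σ x).1.2 hγ g
  rw [Subgroup.coe_mk, ← mul_assoc] at h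
  rw [hσm]
  exact h

/-- Joint continuity of `(x, g) ↦ ψ(σ(x)·g)`. [cite: MoeglinWaldspurger1995, §II.1.3] -/
theorem continuous_apply_sigma_mul {M : Type*} [TopologicalSpace M] {ψ : (quasiSplit F E c 2).Adelic → M} (hψc : Continuous ψ)
    {σ : ideleGroup E → ↥(torusInBorel F E c 2)} (hσc : Continuous σ) :
    Continuous fun q : ideleGroup E × (quasiSplit F E c 2).Adelic => ψ ((σ q.1).1.1 * q.2) :=
  hψc.comp ((continuous_subtype_val.comp (continuous_subtype_val.comp (hσc.comp continuous_fst))).mul continuous_snd)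

/-! ## §4 Descent to the idele class group: the jointly continuous kernel `Φ(c, g)` on `C_E × G` -/

/-- **Descent.**  For continuous left-`N(𝔸)B(F)`-invariant `ψ` the function `(x, g) ↦ ψ(σ(x)·g)` is `E^×`-invariant in `x`, hence descends to a kernel `Φ : C_E × G → M`,
jointly continuous (the quotient map `𝕀_E × G → C_E × G` is open). [cite: MoeglinWaldspurger1995, §II.1.3] -/
theorem exists_kernel (hc : c * c = 1) {M : Type*} [TopologicalSpace M] {ψ : (quasiSplit F E c 2).Adelic → M} (hψc : Continuous ψ)
    (hψU : ∀ (u : adelicUnipotent F E c 2) (g : (quasiSplit F E c 2).Adelic), ψ ((u : (quasiSplit F E c 2).Adelic) * g) = ψ g)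
    (hψB : ∀ γ ∈ arithmeticBorel F E c 2, ∀ g : (quasiSplit F E c 2).Adelic, ψ ((γ : (quasiSplit F E c 2).Adelic) * g) = ψ g)
    {σ : ideleGroup E → ↥(torusInBorel F E c 2)} (hσc : Continuous σ) (hσm : ∀ x y, σ (x * y) = σ x * σ y)
    (hσt : ∀ t : ↥(torusInBorel F E c 2), σ (firstEntryUnit t.1.2) = t) :
    ∃ Φ : IdeleClassGroup E → (quasiSplit F E c 2).Adelic → M,
      (∀ (x : ideleGroup E) (g : (quasiSplit F E c 2).Adelic), Φ (x : IdeleClassGroup E) g = ψ ((σ x).1.1 * g)) ∧ Continuous (uncurry Φ) := by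
  classical
  set Φ : IdeleClassGroup E → (quasiSplit F E c 2).Adelic → M := fun y g => ψ ((σ (Quotient.out y : ideleGroup E)).1.1 * g) with hΦ
  have hΦx : ∀ (x : ideleGroup E) (g : (quasiSplit F E c 2).Adelic), Φ (x : IdeleClassGroup E) g = ψ ((σ x).1.1 * g) := fun x g => by
    obtain ⟨h, hh⟩ := QuotientGroup.mk_out_eq_mul (principalIdeles E) x
    show ψ ((σ (Quotient.out (x : IdeleClassGroup E) : ideleGroup E)).1.1 * g) = _
    rw [hh]
    exact apply_sigma_mul_of_mem_principalIdeles hc hψU hψB hσm hσt x h.2 g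
  refine ⟨Φ, hΦx, ?_⟩
  have hq : IsOpenQuotientMap (Prod.map ((↑) : ideleGroup E → IdeleClassGroup E) (id : (quasiSplit F E c 2).Adelic → (quasiSplit F E c 2).Adelic)) :=
    (QuotientGroup.isOpenQuotientMap_mk (N := principalIdeles E)).prodMap IsOpenQuotientMap.id
  rw [← hq.continuous_comp_iff]
  have hcomp : uncurry Φ ∘ Prod.map ((↑) : ideleGroup E → IdeleClassGroup E) id = fun q : ideleGroup E × (quasiSplit F E c 2).Adelic => ψ ((σ q.1).1.1 * q.2) :=
    funext fun q => hΦx q.1 q.2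
  rw [hcomp]
  exact continuous_apply_sigma_mul hψc hσc

/-- **Borel transport on the kernel**: `Φ(c, b·g) = Φ(c·[b₀₀], g)` for `b ∈ B(𝔸_F)`. [cite: MoeglinWaldspurger1995, §II.1.3] -/
theorem kernel_borel_mul {M : Type*} {ψ : (quasiSplit F E c 2).Adelic → M}
    (hψU : ∀ (u : adelicUnipotent F E c 2) (g : (quasiSplit F E c 2).Adelic), ψ ((u : (quasiSplit F E c 2).Adelic) * g) = ψ g)
    {σ : ideleGroup E → ↥(torusInBorel F E c 2)} (hσm : ∀ x y, σ (x * y) = σ x * σ y) (hσt : ∀ t : ↥(torusInBorel F E c 2), σ (firstEntryUnit t.1.2) = t)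
    {Φ : IdeleClassGroup E → (quasiSplit F E c 2).Adelic → M} (hΦ : ∀ (x : ideleGroup E) (g : (quasiSplit F E c 2).Adelic), Φ (x : IdeleClassGroup E) g = ψ ((σ x).1.1 * g))
    (y : IdeleClassGroup E) {b : (quasiSplit F E c 2).Adelic} (hb : b ∈ borelAdelic F E c 2) (g : (quasiSplit F E c 2).Adelic) :
    Φ y (b * g) = Φ (y * (firstEntryUnit hb : ideleGroup E)) g := by
  induction y using QuotientGroup.induction_on with
  | H x => rw [← QuotientGroup.mk_mul, hΦ, hΦ, apply_sigma_mul_borel_mul hψU hσm hσt x hb g]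

/-- **`B(F)`-invariance of the kernel in `g`**: `Φ(c, γ·g) = Φ(c, g)` for `γ ∈ B(F)`. [cite: MoeglinWaldspurger1995, §II.1.3] -/
theorem kernel_rational_mul {M : Type*} {ψ : (quasiSplit F E c 2).Adelic → M}
    (hψU : ∀ (u : adelicUnipotent F E c 2) (g : (quasiSplit F E c 2).Adelic), ψ ((u : (quasiSplit F E c 2).Adelic) * g) = ψ g)
    (hψB : ∀ γ ∈ arithmeticBorel F E c 2, ∀ g : (quasiSplit F E c 2).Adelic, ψ ((γ : (quasiSplit F E c 2).Adelic) * g) = ψ g)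
    {σ : ideleGroup E → ↥(torusInBorel F E c 2)}
    {Φ : IdeleClassGroup E → (quasiSplit F E c 2).Adelic → M} (hΦ : ∀ (x : ideleGroup E) (g : (quasiSplit F E c 2).Adelic), Φ (x : IdeleClassGroup E) g = ψ ((σ x).1.1 * g))
    (y : IdeleClassGroup E) {γ : ↥(quasiSplit F E c 2).arithmeticSubgroup} (hγ : γ ∈ arithmeticBorel F E c 2) (g : (quasiSplit F E c 2).Adelic) :
    Φ y ((γ : (quasiSplit F E c 2).Adelic) * g) = Φ y g := by
  induction y using QuotientGroup.induction_on with
  | H x => rw [hΦ, hΦ, apply_borel_mul_rational_mul hψU hψB (σ x).1.2 hγ g]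

/-- **Right translates**: a right-invariance of `ψ` (e.g. under `K'`) passes to the kernel. [cite: MoeglinWaldspurger1995, §II.1.3] -/
theorem kernel_mul_right {M : Type*} {ψ : (quasiSplit F E c 2).Adelic → M} {σ : ideleGroup E → ↥(torusInBorel F E c 2)}
    {Φ : IdeleClassGroup E → (quasiSplit F E c 2).Adelic → M} (hΦ : ∀ (x : ideleGroup E) (g : (quasiSplit F E c 2).Adelic), Φ (x : IdeleClassGroup E) g = ψ ((σ x).1.1 * g))
    {g k : (quasiSplit F E c 2).Adelic} (hk : ∀ h : (quasiSplit F E c 2).Adelic, ψ (h * k) = ψ h) (y : IdeleClassGroup E) : Φ y (g * k) = Φ y g := by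
  induction y using QuotientGroup.induction_on with
  | H x => rw [hΦ, hΦ, ← mul_assoc, hk]

/-! ## §5 The band: `Φ(c, g) ≠ 0 ⇒ a ≤ ‖c‖·H(g) ≤ b`, a compact shell of `C_E` -/

/-- **Support of the kernel in the class variable.**  If `ψ` lives in the height band `[a, b]` then `Φ(c, g) ≠ 0` forces `a ≤ ‖c‖·H(g) ≤ b` (`H(σ(x) g) = ‖x‖ H(g)`).
[cite: MoeglinWaldspurger1995, §II.1.3] [cite: Garrett2018, §2.2] -/
theorem norm_mul_borelHeight_mem_of_kernel_ne_zero {M : Type*} [Zero M] {ψ : (quasiSplit F E c 2).Adelic → M} {a b : ℝ≥0}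
    (hband : ∀ g, ψ g ≠ 0 → a ≤ borelHeight g ∧ borelHeight g ≤ b)
    {σ : ideleGroup E → ↥(torusInBorel F E c 2)} (hσ₀ : ∀ x, firstEntryUnit (σ x).1.2 = x)
    {Φ : IdeleClassGroup E → (quasiSplit F E c 2).Adelic → M} (hΦ : ∀ (x : ideleGroup E) (g : (quasiSplit F E c 2).Adelic), Φ (x : IdeleClassGroup E) g = ψ ((σ x).1.1 * g))
    {y : IdeleClassGroup E} {g : (quasiSplit F E c 2).Adelic} (h : Φ y g ≠ 0) :
    a ≤ IdeleClassGroup.norm E y * borelHeight g ∧ IdeleClassGroup.norm E y * borelHeight g ≤ b := by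
  induction y using QuotientGroup.induction_on with
  | H x =>
    rw [hΦ] at h
    have hH := borelHeight_borel_mul_firstEntryUnit (σ x).1.2 g
    rw [hσ₀] at hH
    rw [IdeleClassGroup.norm_mk, ← hH]
    exact hband _ h

/-- **The shell is compact**: for `0 < a` and any `g`, `{c ∈ C_E : a ≤ ‖c‖·H(g) ≤ b}` is compact (`H(g) > 0`; norm shells of `C_E = C_E¹ × ℝ_{>0}` are compact, ★
`isCompact_norm_preimage_of_isCompact`). [cite: CasselsFrohlichANT1967, Ch. II §16] -/
theorem isCompact_shell {a : ℝ≥0} (ha : 0 < a) (b : ℝ≥0) (g : (quasiSplit F E c 2).Adelic) :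
    IsCompact {y : IdeleClassGroup E | a ≤ IdeleClassGroup.norm E y * borelHeight g ∧ IdeleClassGroup.norm E y * borelHeight g ≤ b} := by
  have hH : 0 < borelHeight g := borelHeight_pos g
  have hset : {y : IdeleClassGroup E | a ≤ IdeleClassGroup.norm E y * borelHeight g ∧ IdeleClassGroup.norm E y * borelHeight g ≤ b} =
      IdeleClassGroup.norm E ⁻¹' Icc (a / borelHeight g) (b / borelHeight g) := by
    ext y
    simp only [mem_setOf_eq, mem_preimage, mem_Icc, div_le_iff₀ hH, le_div_iff₀ hH]
  rw [hset]
  refine isCompact_norm_preimage_of_isCompact E isCompact_Icc fun h0 => ?_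
  exact (lt_irrefl (0 : ℝ≥0)) (lt_of_lt_of_le (div_pos ha hH) h0.1 |>.trans_le le_rfl)

/-- **Consequently `c ↦ Φ(c, g)` vanishes outside a compact set** (for `0 < a`). [cite: MoeglinWaldspurger1995, §II.1.3] -/
theorem exists_isCompact_kernel_eq_zero {M : Type*} [Zero M] {ψ : (quasiSplit F E c 2).Adelic → M} {a b : ℝ≥0} (ha : 0 < a)
    (hband : ∀ g, ψ g ≠ 0 → a ≤ borelHeight g ∧ borelHeight g ≤ b)
    {σ : ideleGroup E → ↥(torusInBorel F E c 2)} (hσ₀ : ∀ x, firstEntryUnit (σ x).1.2 = x)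
    {Φ : IdeleClassGroup E → (quasiSplit F E c 2).Adelic → M} (hΦ : ∀ (x : ideleGroup E) (g : (quasiSplit F E c 2).Adelic), Φ (x : IdeleClassGroup E) g = ψ ((σ x).1.1 * g))
    (g : (quasiSplit F E c 2).Adelic) :
    ∃ S : Set (IdeleClassGroup E), IsCompact S ∧ ∀ y ∉ S, Φ y g = 0 :=
  ⟨_, isCompact_shell ha b g, fun y hy => not_not.1 fun h => hy (norm_mul_borelHeight_mem_of_kernel_ne_zero (y := y) hband hσ₀ hΦ h)⟩

end Summit.HodgeConjecture.HodgeConjecture.Cruxes.H413.K2E1NormOneTorusFamilyActionU2
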